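import Summits.HubbardSuperconductivity.HubbardSuperconductivity.Theorems.BirComplexStableXY.Negative.WitnessTable
import HarnessLib

/-!
# Crux `BirComplexStableXYR`, line `fat-gaussian-defect-calculus`, stub S1 (`stub_cubicNormalForm`):
# kernel lemmas — window symmetries, the Im-Hessian coefficient matrix, the pairing lemma,
# edge frequencies and the correction table

Part 1 of 2 of the proof of the registered stub `stub_cubicNormalForm` (the stub itself is in
`BalabanIRBirComplexStableXYRStubCubicNormalForm.lean`).  For a table `c : Table r` let
`A_{ww'} := Σ_n Im(c_n) n_w n_{w'}` (coefficient matrix of the imaginary window Hessian at zero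
field) and, for a real kernel `A`, `d_A := Σ_{(w,w')} (A_{ww'}/2)·i·δ_{e_w − e_{w'}}`.  Contents:

* `cnf_A_symm/rowsum/colsum/R/P/iota` — symmetry, zero row sums (zero-sum support), oddness under
  the time reflection (R), evenness under the spatial rotation (P), oddness under the point
  reflection `ι = R∘P`;
* **`cnf_sum_pair_eq_zero`** (pairing lemma) — `Σ_{w,w'} A_{ww'}·G(w,w') = 0` for symmetric,
  `ι`-odd `A` and every `G` with `G(ιw,ιw') = G(w',w)`;
* `cnf_sum_delta_mul`, `cnf_sum_delta`, `cnf_sum_abs_delta_le`, `cnf_delta_comp(_eq_iff)` — edge frequencies;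
* `cnf_d_apply`, `cnf_d_zeroSum`, `cnf_d_R`, `cnf_d_P`, `cnf_d_conj_neg` — the correction table;
* `cnf_tsum_sum`, `cnf_genF_sum`, `cnf_normA_sum_le`, `cnf_imH_sum` — table functionals of finite sums.
No definitions; sorry-free (escalated route prover, seat 0).
-/

noncomputable section

set_option linter.dupNamespace false -- summit = problem name (single-conjunct summit), D-0017

namespace Summit.HubbardSuperconductivity.HubbardSuperconductivity.Theorems.FatGaussian

open scoped BigOperators ComplexConjugate
open Finset Summit.HubbardSuperconductivity.BirComplexStableXYNegative

variable {r : ℕ}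

/-! ### Window symmetries -/

/-- Time reflection of the window, `R w = (w₁, w₂, rev w₃)`. [folklore] -/
theorem cnf_R_involutive :
    Function.Involutive (fun w : W r => ((w.1, w.2.1, Fin.rev w.2.2) : W r)) := by
  intro w; simp

/-- Spatial π-rotation of the window, `P w = (rev w₁, rev w₂, w₃)`. [folklore] -/
theorem cnf_P_involutive :
    Function.Involutive (fun w : W r => ((Fin.rev w.1, Fin.rev w.2.1, w.2.2) : W r)) := by
  intro w; simp

/-- Point reflection of the window, `ι w = (rev w₁, rev w₂, rev w₃)`. [folklore] -/
theorem cnf_iota_involutive :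
    Function.Involutive (fun w : W r => ((Fin.rev w.1, Fin.rev w.2.1, Fin.rev w.2.2) : W r)) := by
  intro w; simp

/-! ### The coefficient matrix `A_{ww'} = Σ_n Im(c_n) n_w n_{w'}` of the imaginary window Hessian -/

/-- `A` is symmetric. [folklore] -/
theorem cnf_A_symm (c : Table r) (w w' : W r) :
    c.sum (fun n a => a.im * ((n w : ℝ) * (n w' : ℝ))) =
      c.sum (fun n a => a.im * ((n w' : ℝ) * (n w : ℝ))) := by
  simp only [mul_comm]

/-- Zero-sum frequencies give zero row sums of `A`. [folklore] -/
theorem cnf_A_rowsum (c : Table r) (hzs : ∀ n ∈ c.support, ∑ w, n w = 0) (w : W r) :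
    ∑ w', c.sum (fun n a => a.im * ((n w : ℝ) * (n w' : ℝ))) = 0 := by
  simp only [Finsupp.sum]
  rw [Finset.sum_comm]
  refine Finset.sum_eq_zero fun n hn => ?_
  have h0 : ∑ w', (n w' : ℝ) = 0 := by exact_mod_cast hzs n hn
  simp only [← mul_assoc, ← Finset.mul_sum, h0, mul_zero]

/-- Zero-sum frequencies give zero column sums of `A`. [folklore] -/
theorem cnf_A_colsum (c : Table r) (hzs : ∀ n ∈ c.support, ∑ w, n w = 0) (w' : W r) :
    ∑ w, c.sum (fun n a => a.im * ((n w : ℝ) * (n w' : ℝ))) = 0 := by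
  simp only [cnf_A_symm c _ w']
  exact cnf_A_rowsum c hzs w'

/-- (R) makes `A` odd under time reflection: `A_{Rw,Rw'} = −A_{ww'}`. [folklore] -/
theorem cnf_A_R (c : Table r)
    (hR : ∀ n : Freq r, c (fun w => n (w.1, w.2.1, Fin.rev w.2.2)) = conj (c (-n))) (w w' : W r) :
    c.sum (fun n a => a.im * ((n (w.1, w.2.1, Fin.rev w.2.2) : ℝ) * (n (w'.1, w'.2.1, Fin.rev w'.2.2) : ℝ))) =
      -c.sum (fun n a => a.im * ((n w : ℝ) * (n w' : ℝ))) := by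
  classical
  -- the involution `ρ n = (−n) ∘ R` of the support
  set ρ : Freq r → Freq r := fun n => fun u => -n (u.1, u.2.1, Fin.rev u.2.2) with hρ
  have hρρ : Function.Involutive ρ := by
    intro n; funext u; simp [hρ]
  have hcρ : ∀ n, c (ρ n) = conj (c n) := by
    intro n
    have h := hR (-n)
    simp only [Pi.neg_apply, neg_neg] at h
    convert h using 2
  have hsupp : ∀ n, n ∈ c.support ↔ ρ n ∈ c.support := by
    intro n
    simp only [Finsupp.mem_support_iff, hcρ, ne_eq, map_eq_zero]
  simp only [Finsupp.sum]
  rw [← Finset.sum_neg_distrib]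
  refine Finset.sum_equiv (hρρ.toPerm ρ) (fun n => hsupp n) fun n hn => ?_
  simp only [Function.Involutive.coe_toPerm]
  rw [hcρ, Complex.conj_im]
  simp only [hρ, Int.cast_neg]
  ring

/-- (P) makes `A` even under the spatial π-rotation: `A_{Pw,Pw'} = A_{ww'}`. [folklore] -/
theorem cnf_A_P (c : Table r)
    (hP : ∀ n : Freq r, c (fun w => n (Fin.rev w.1, Fin.rev w.2.1, w.2.2)) = c n) (w w' : W r) :
    c.sum (fun n a => a.im * ((n (Fin.rev w.1, Fin.rev w.2.1, w.2.2) : ℝ) * (n (Fin.rev w'.1, Fin.rev w'.2.1, w'.2.2) : ℝ))) =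
      c.sum (fun n a => a.im * ((n w : ℝ) * (n w' : ℝ))) := by
  classical
  set π : Freq r → Freq r := fun n => fun u => n (Fin.rev u.1, Fin.rev u.2.1, u.2.2) with hπ
  have hππ : Function.Involutive π := by
    intro n; funext u; simp [hπ]
  have hcπ : ∀ n, c (π n) = c n := fun n => hP n
  have hsupp : ∀ n, n ∈ c.support ↔ π n ∈ c.support := by
    intro n
    simp only [Finsupp.mem_support_iff, hcπ]
  simp only [Finsupp.sum]
  refine Finset.sum_equiv (hππ.toPerm π) (fun n => hsupp n) fun n hn => ?_
  simp only [Function.Involutive.coe_toPerm]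
  rw [hcπ]

/-- (R)+(P): `A` is odd under the point reflection `ι`: `A_{ιw,ιw'} = −A_{ww'}`. [folklore] -/
theorem cnf_A_iota (c : Table r)
    (hR : ∀ n : Freq r, c (fun w => n (w.1, w.2.1, Fin.rev w.2.2)) = conj (c (-n)))
    (hP : ∀ n : Freq r, c (fun w => n (Fin.rev w.1, Fin.rev w.2.1, w.2.2)) = c n) (w w' : W r) :
    c.sum (fun n a => a.im * ((n (Fin.rev w.1, Fin.rev w.2.1, Fin.rev w.2.2) : ℝ) *
      (n (Fin.rev w'.1, Fin.rev w'.2.1, Fin.rev w'.2.2) : ℝ))) =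
      -c.sum (fun n a => a.im * ((n w : ℝ) * (n w' : ℝ))) := by
  have h1 := cnf_A_R c hR (Fin.rev w.1, Fin.rev w.2.1, w.2.2) (Fin.rev w'.1, Fin.rev w'.2.1, w'.2.2)
  rw [cnf_A_P c hP] at h1
  exact h1

/-! ### The pairing lemma -/

/-- **Pairing lemma.**  If a real kernel `A` on `W × W` is symmetric and odd under the point
reflection `ι`, then `Σ_{w,w'} A_{ww'}·G(w,w') = 0` for every `G` (with values in a real vector
space) satisfying `G(ιw, ιw') = G(w', w)` — e.g. every `G` depending only on the displacement
`w' − w`. [folklore] -/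
theorem cnf_sum_pair_eq_zero {V : Type*} [AddCommGroup V] [Module ℝ V] (A : W r → W r → ℝ)
    (hsymm : ∀ w w', A w w' = A w' w)
    (hodd : ∀ w w', A (Fin.rev w.1, Fin.rev w.2.1, Fin.rev w.2.2) (Fin.rev w'.1, Fin.rev w'.2.1, Fin.rev w'.2.2) = -A w w')
    (G : W r → W r → V)
    (hG : ∀ w w', G (Fin.rev w.1, Fin.rev w.2.1, Fin.rev w.2.2) (Fin.rev w'.1, Fin.rev w'.2.1, Fin.rev w'.2.2) = G w' w) :
    ∑ w, ∑ w', A w w' • G w w' = 0 := by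
  set ι : W r → W r := fun w => (Fin.rev w.1, Fin.rev w.2.1, Fin.rev w.2.2) with hι
  have hιι : Function.Involutive ι := cnf_iota_involutive
  set S : V := ∑ w, ∑ w', A w w' • G w w' with hS
  -- reindex both sums by `ι`
  have h1 : S = ∑ w, ∑ w', A (ι w) (ι w') • G (ι w) (ι w') := by
    rw [hS]
    rw [← Equiv.sum_comp (hιι.toPerm ι) (fun w => ∑ w', A w w' • G w w')]
    refine Finset.sum_congr rfl fun w _ => ?_
    rw [← Equiv.sum_comp (hιι.toPerm ι) (fun w' => A _ w' • G _ w')]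
    rfl
  -- use oddness of `A`, the covariance of `G`, and swap the summation order
  have h2 : S = -S := by
    conv_lhs => rw [h1]
    simp only [hι, hodd, hG, neg_smul, Finset.sum_neg_distrib]
    rw [Finset.sum_comm]
    simp only [hsymm, hS]
  have h3 : (2 : ℝ) • S = 0 := by rw [two_smul]; nth_rewrite 2 [h2]; exact add_neg_cancel S
  exact (smul_eq_zero.mp h3).resolve_left two_ne_zero


/-- **Pairing lemma, complex-valued closed form (registered sub-goal `cnf_pairing` of stub S1).**
For a symmetric real kernel `A` on the window that is odd under the point reflection `ι`, and any
complex `G` with `G(ιw,ιw') = G(w',w)`: `Σ_{w,w'} A_{ww'} G(w,w') = 0`. [folklore] -/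
theorem cnf_pairing : ∀ (r : ℕ) (A : W r → W r → ℝ), (∀ w w', A w w' = A w' w) → (∀ w w', A (Fin.rev w.1, Fin.rev w.2.1, Fin.rev w.2.2) (Fin.rev w'.1, Fin.rev w'.2.1, Fin.rev w'.2.2) = -A w w') → ∀ G : W r → W r → ℂ, (∀ w w', G (Fin.rev w.1, Fin.rev w.2.1, Fin.rev w.2.2) (Fin.rev w'.1, Fin.rev w'.2.1, Fin.rev w'.2.2) = G w' w) → ∑ w, ∑ w', (A w w' : ℂ) * G w w' = 0 := by
  intro r A hsymm hodd G hG
  have h := cnf_sum_pair_eq_zero (V := ℂ) A hsymm hodd G hG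
  simpa only [Complex.real_smul] using h

/-! ### Edge frequencies `δ_p = e_{p.1} − e_{p.2}` -/

/-- `Σ_w δ_p(w) φ_w = φ_{p.1} − φ_{p.2}`. [folklore] -/
theorem cnf_sum_delta_mul (p : W r × W r) (φ : W r → ℝ) :
    (∑ w, (((Pi.single p.1 (1:ℤ) - Pi.single p.2 (1:ℤ) : Freq r) w : ℤ) : ℝ) * φ w) = φ p.1 - φ p.2 := by
  simp [Pi.single_apply, sub_mul, Finset.sum_sub_distrib]

/-- `δ_p` is zero-sum. [folklore] -/
theorem cnf_sum_delta (p : W r × W r) : ∑ w, (Pi.single p.1 (1:ℤ) - Pi.single p.2 (1:ℤ) : Freq r) w = 0 := by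
  simp [Finset.sum_sub_distrib]

/-- `‖δ_p‖₁ ≤ 2`. [folklore] -/
theorem cnf_sum_abs_delta_le (p : W r × W r) :
    (∑ w, |(((Pi.single p.1 (1:ℤ) - Pi.single p.2 (1:ℤ) : Freq r) w : ℤ) : ℝ)|) ≤ 2 := by
  have key : ∀ w, |(((Pi.single p.1 (1:ℤ) - Pi.single p.2 (1:ℤ) : Freq r) w : ℤ) : ℝ)| ≤
      (if w = p.1 then 1 else 0) + (if w = p.2 then 1 else 0) := by
    intro w
    by_cases h1 : w = p.1
    · subst h1
      by_cases h2 : p.1 = p.2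
      · simp [h2]
      · simp [h2]
    · by_cases h2 : w = p.2
      · subst h2; simp [h1]
      · simp [h1, h2]
  calc (∑ w, |(((Pi.single p.1 (1:ℤ) - Pi.single p.2 (1:ℤ) : Freq r) w : ℤ) : ℝ)|)
      ≤ ∑ w : W r, ((if w = p.1 then (1:ℝ) else 0) + (if w = p.2 then 1 else 0)) := Finset.sum_le_sum fun w _ => key w
    _ = 2 := by rw [Finset.sum_add_distrib, Finset.sum_ite_eq', Finset.sum_ite_eq']; simp; norm_num

/-- `δ_{swap p} = −δ_p`. [folklore] -/
theorem cnf_delta_swap (p : W r × W r) :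
    (Pi.single p.2 (1:ℤ) - Pi.single p.1 (1:ℤ) : Freq r) = -(Pi.single p.1 (1:ℤ) - Pi.single p.2 (1:ℤ)) := by
  abel

/-- `δ` transported by an involution `σ` of the window: `δ_{(σp₁,σp₂)}(u) = δ_p(σ u)`. [folklore] -/
theorem cnf_delta_comp {σ : W r → W r} (hσ : Function.Involutive σ) (p : W r × W r) (u : W r) :
    (Pi.single (σ p.1) (1:ℤ) - Pi.single (σ p.2) (1:ℤ) : Freq r) u =
      (Pi.single p.1 (1:ℤ) - Pi.single p.2 (1:ℤ) : Freq r) (σ u) := by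
  have h1 : (u = σ p.1) ↔ (σ u = p.1) := by
    constructor
    · intro h; rw [h, hσ]
    · intro h; rw [← h, hσ]
  have h2 : (u = σ p.2) ↔ (σ u = p.2) := by
    constructor
    · intro h; rw [h, hσ]
    · intro h; rw [← h, hσ]
  simp only [Pi.sub_apply, Pi.single_apply, h1, h2]

/-- The transported indicator: `δ_{(σp₁,σp₂)} = n ∘ σ ↔ δ_p = n`. [folklore] -/
theorem cnf_delta_comp_eq_iff {σ : W r → W r} (hσ : Function.Involutive σ) (p : W r × W r) (n : Freq r) :
    ((Pi.single (σ p.1) (1:ℤ) - Pi.single (σ p.2) (1:ℤ) : Freq r) = fun u => n (σ u)) ↔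
      ((Pi.single p.1 (1:ℤ) - Pi.single p.2 (1:ℤ) : Freq r) = n) := by
  constructor
  · intro h
    funext u
    have := congrFun h (σ u)
    rw [cnf_delta_comp hσ, hσ u] at this
    exact this
  · intro h
    funext u
    rw [cnf_delta_comp hσ, h]

/-! ### The correction table `d = Σ_p (i/2) A_p · δ_p` for a kernel `A` -/

/-- Pointwise evaluation of `d`. [folklore] -/
theorem cnf_d_apply (A : W r → W r → ℝ) (n : Freq r) :
    (∑ p : W r × W r, Finsupp.single (Pi.single p.1 (1:ℤ) - Pi.single p.2 (1:ℤ) : Freq r)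
        (((A p.1 p.2 / 2 : ℝ) : ℂ) * Complex.I)) n =
      ∑ p : W r × W r, if (Pi.single p.1 (1:ℤ) - Pi.single p.2 (1:ℤ) : Freq r) = n
        then ((A p.1 p.2 / 2 : ℝ) : ℂ) * Complex.I else 0 := by
  rw [Finsupp.finsetSum_apply]
  refine Finset.sum_congr rfl fun p _ => ?_
  rw [Finsupp.single_apply]

/-- `d` has zero-sum support. [folklore] -/
theorem cnf_d_zeroSum (A : W r → W r → ℝ) :
    ∀ n ∈ (∑ p : W r × W r, Finsupp.single (Pi.single p.1 (1:ℤ) - Pi.single p.2 (1:ℤ) : Freq r)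
        (((A p.1 p.2 / 2 : ℝ) : ℂ) * Complex.I)).support, ∑ w, n w = 0 := by
  classical
  intro n hn
  have h := Finsupp.support_finsetSum hn
  rw [Finset.mem_biUnion] at h
  obtain ⟨p, _, hp⟩ := h
  have h2 := Finsupp.support_single_subset hp
  rw [Finset.mem_singleton] at h2
  rw [h2]
  exact cnf_sum_delta p

/-- `d` under the time reflection: `d(n ∘ R) = −d(n)` when `A_{Rw,Rw'} = −A_{ww'}`. [folklore] -/
theorem cnf_d_R (A : W r → W r → ℝ)
    (hAR : ∀ w w', A (w.1, w.2.1, Fin.rev w.2.2) (w'.1, w'.2.1, Fin.rev w'.2.2) = -A w w') (n : Freq r) :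
    (∑ p : W r × W r, Finsupp.single (Pi.single p.1 (1:ℤ) - Pi.single p.2 (1:ℤ) : Freq r)
        (((A p.1 p.2 / 2 : ℝ) : ℂ) * Complex.I)) (fun w => n (w.1, w.2.1, Fin.rev w.2.2)) =
      -(∑ p : W r × W r, Finsupp.single (Pi.single p.1 (1:ℤ) - Pi.single p.2 (1:ℤ) : Freq r)
        (((A p.1 p.2 / 2 : ℝ) : ℂ) * Complex.I)) n := by
  classical
  rw [cnf_d_apply, cnf_d_apply, ← Finset.sum_neg_distrib]
  have hRR : Function.Involutive (fun w : W r => ((w.1, w.2.1, Fin.rev w.2.2) : W r)) :=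
    cnf_R_involutive
  symm
  refine Fintype.sum_equiv (Equiv.prodCongr (hRR.toPerm _) (hRR.toPerm _)) _ _ fun p => ?_
  have hiff := cnf_delta_comp_eq_iff hRR p n
  simp only [Equiv.prodCongr_apply, Prod.map_fst, Prod.map_snd,
    Function.Involutive.coe_toPerm] at hiff ⊢
  by_cases h : (Pi.single p.1 (1:ℤ) - Pi.single p.2 (1:ℤ) : Freq r) = n
  · rw [if_pos h, if_pos (hiff.mpr h), hAR]
    push_cast
    ring
  · rw [if_neg h, if_neg (fun h' => h (hiff.mp h')), neg_zero]

/-- `d` under the spatial rotation: `d(n ∘ P) = d(n)` when `A_{Pw,Pw'} = A_{ww'}`. [folklore] -/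
theorem cnf_d_P (A : W r → W r → ℝ)
    (hAP : ∀ w w', A (Fin.rev w.1, Fin.rev w.2.1, w.2.2) (Fin.rev w'.1, Fin.rev w'.2.1, w'.2.2) = A w w') (n : Freq r) :
    (∑ p : W r × W r, Finsupp.single (Pi.single p.1 (1:ℤ) - Pi.single p.2 (1:ℤ) : Freq r)
        (((A p.1 p.2 / 2 : ℝ) : ℂ) * Complex.I)) (fun w => n (Fin.rev w.1, Fin.rev w.2.1, w.2.2)) =
      (∑ p : W r × W r, Finsupp.single (Pi.single p.1 (1:ℤ) - Pi.single p.2 (1:ℤ) : Freq r)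
        (((A p.1 p.2 / 2 : ℝ) : ℂ) * Complex.I)) n := by
  classical
  rw [cnf_d_apply, cnf_d_apply]
  have hPP : Function.Involutive (fun w : W r => ((Fin.rev w.1, Fin.rev w.2.1, w.2.2) : W r)) :=
    cnf_P_involutive
  symm
  refine Fintype.sum_equiv (Equiv.prodCongr (hPP.toPerm _) (hPP.toPerm _)) _ _ fun p => ?_
  have hiff := cnf_delta_comp_eq_iff hPP p n
  simp only [Equiv.prodCongr_apply, Prod.map_fst, Prod.map_snd,
    Function.Involutive.coe_toPerm] at hiff ⊢
  by_cases h : (Pi.single p.1 (1:ℤ) - Pi.single p.2 (1:ℤ) : Freq r) = n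
  · rw [if_pos h, if_pos (hiff.mpr h), hAP]
  · rw [if_neg h, if_neg (fun h' => h (hiff.mp h'))]

/-- `conj d(−n) = −d(n)` when `A` is symmetric. [folklore] -/
theorem cnf_d_conj_neg (A : W r → W r → ℝ) (hsymm : ∀ w w', A w w' = A w' w) (n : Freq r) :
    conj ((∑ p : W r × W r, Finsupp.single (Pi.single p.1 (1:ℤ) - Pi.single p.2 (1:ℤ) : Freq r)
        (((A p.1 p.2 / 2 : ℝ) : ℂ) * Complex.I)) (-n)) =
      -(∑ p : W r × W r, Finsupp.single (Pi.single p.1 (1:ℤ) - Pi.single p.2 (1:ℤ) : Freq r)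
        (((A p.1 p.2 / 2 : ℝ) : ℂ) * Complex.I)) n := by
  classical
  rw [cnf_d_apply, cnf_d_apply, map_sum, ← Finset.sum_neg_distrib]
  symm
  refine Fintype.sum_equiv (Equiv.prodComm (W r) (W r)) _ _ fun p => ?_
  simp only [Equiv.prodComm_apply, Prod.fst_swap, Prod.snd_swap]
  have hiff : ((Pi.single p.2 (1:ℤ) - Pi.single p.1 (1:ℤ) : Freq r) = -n) ↔
      ((Pi.single p.1 (1:ℤ) - Pi.single p.2 (1:ℤ) : Freq r) = n) := by
    rw [cnf_delta_swap, neg_inj]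
  by_cases h : (Pi.single p.1 (1:ℤ) - Pi.single p.2 (1:ℤ) : Freq r) = n
  · rw [if_pos h, if_pos (hiff.mpr h), hsymm p.2 p.1, map_mul, Complex.conj_I, Complex.conj_ofReal]
    ring
  · rw [if_neg h, if_neg (fun h' => h (hiff.mp h')), neg_zero, map_zero]

/-! ### Table functionals of finite sums of tables -/

/-- `tsum` of a finite sum of tables. [folklore] -/
theorem cnf_tsum_sum {α : Type*} (s : Finset α) (f : α → Table r) :
    Summit.HubbardSuperconductivity.BirComplexStableXYNegative.tsum (∑ i ∈ s, f i) = ∑ i ∈ s, Summit.HubbardSuperconductivity.BirComplexStableXYNegative.tsum (f i) := by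
  classical
  induction s using Finset.induction_on with
  | empty => rw [Finset.sum_empty, Finset.sum_empty, Summit.HubbardSuperconductivity.BirComplexStableXYNegative.tsum_zero]
  | insert a s ha ih => rw [Finset.sum_insert ha, Finset.sum_insert ha, Summit.HubbardSuperconductivity.BirComplexStableXYNegative.tsum_add, ih]

/-- `genF` of a finite sum of tables. [folklore] -/
theorem cnf_genF_sum {α : Type*} (s : Finset α) (f : α → Table r) (φ : W r → ℝ) :
    genF (∑ i ∈ s, f i) φ = ∑ i ∈ s, genF (f i) φ := by
  classical
  induction s using Finset.induction_on with
  | empty => simp [genF_zero]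
  | insert a s ha ih => rw [Finset.sum_insert ha, Finset.sum_insert ha, genF_add, ih]

/-- `normA` of a finite sum of tables. [folklore] -/
theorem cnf_normA_sum_le {α : Type*} (s : Finset α) (f : α → Table r) :
    normA (∑ i ∈ s, f i) ≤ ∑ i ∈ s, normA (f i) := by
  classical
  induction s using Finset.induction_on with
  | empty => simp [normA_zero]
  | insert a s ha ih =>
      rw [Finset.sum_insert ha, Finset.sum_insert ha]
      exact (normA_add_le _ _).trans (by linarith)

/-- The Im-Hessian functional `Σ_n Im(t_n)(n·v)²` of a finite sum of tables. [folklore] -/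
theorem cnf_imH_sum {α : Type*} (s : Finset α) (f : α → Table r) (v : W r → ℝ) :
    (∑ i ∈ s, f i).sum (fun n a => a.im * (∑ w, (n w : ℝ) * v w) ^ 2) =
      ∑ i ∈ s, (f i).sum (fun n a => a.im * (∑ w, (n w : ℝ) * v w) ^ 2) := by
  rw [← Finsupp.sum_finsetSum_index (fun n => by simp) (fun n b₁ b₂ => by
    rw [Complex.add_im]; ring)]

end Summit.HubbardSuperconductivity.HubbardSuperconductivity.Theorems.FatGaussian

end
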